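import Mathlib
import HarnessLib
import Summits.FinalStateConjecture.Statement
import Summits.FinalStateConjecture.FinalStateConjecture.Theses.SpectralSurfaceGravity
import Literature.Geometry.Lorentzian.TrappedSurface
import Literature.Geometry.Lorentzian.KerrSurfaceGravity
import Literature.Geometry.Lorentzian.KerrSchild
import Literature.Geometry.Lorentzian.LocFinalStateSettling

/-!
# Birth skeleton (BC3) of the crux piece `GenericCensoredCollars` (stmt-FinalStateConjecture-18349) of route
# SpectralSurfaceGravity — crux-strategist 2026-08-17

Two registered stubs and the kernel-checked composition `GenericCensoredCollars_of : Theses.SpectralSurfaceGravity.GenericCensoredCollars` (registered shape: zero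
hypotheses, the stubs used inside, through the frame lemma `genericCensoredCollars_frame` whose hypotheses are the stub statements). The cut follows the route's own physics read at the level of LABELS:

* `stub_genericCensorshipSubextremal` — ONE tame-generic statement (genericity is not `∧`-closed): generically every
  MGHD has complete `𝓘⁺` AND every `C²_loc` settling of it (if any) has SUB-EXTREMAL labels `|aᵢ| < Mᵢ` (generic weak
  cosmic censorship + generic third law in label form; cf. `PhotonSphereChannels.TameCensorship`, which bundles "no
  extremal remnant" with censorship in the same way).
* `stub_subextremalCollars` — for ALL data: a `C²_loc` settling all of whose holes are sub-extremal can be re-charted into a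
  `C²_loc` settling WITH red-shifted collars (horizon regularity slaved to sub-extremality: red-shift decay across `𝓗⁺`
  gives the uniform `C³` collar bounds; a late MOTT in the extended Kerr–Schild slicing by barrier arguments
  (Andersson–Metzger 2009, Andersson–Mars–Simon 2008 §5); `κ_ql → κ(M,a) > 0` by the Kerr calibration).
Composition: genericity is monotone in the property; pointwise the label statement feeds the collar construction.
-/

set_option linter.dupNamespace false

noncomputable section

open scoped BigOperators Topology Manifold Classical MeasureTheory ProbabilityTheory Matrix InnerProductSpace ComplexConjugate ContinuousMap
open Filter Set Function TopologicalSpace MeasureTheory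

namespace Summit.FinalStateConjecture.FinalStateConjecture.Cruxes.GenericCensoredCollars.Birth

/-- **stub** — tame-generic censorship with sub-extremal final labels: for every `X`, tame-Christodoulou-generically in
the admissible class, every MGHD has complete `𝓘⁺` and every `C²_loc` settling `(O, q)` of it has `|aᵢ| < Mᵢ` for
every hole. Why plausibly true: extremal formation sits on thresholds of expected positive codimension (Kehle–Unger
2024); why it might fail: contains tame-generic WCC. Size: open-problem class (it is the censorship half of the piece).
Leans on: `IsTameChristodoulouGeneric`, `CauchyDevelopment.IsLocSettling`, `Kerr.IsSubextremal`. -/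
theorem stub_genericCensorshipSubextremal :
    ∀ (X : Type) [TopologicalSpace X] [ChartedSpace Literature.Geometry.Lorentzian.E3 X] [IsManifold (𝓡 3) ((⊤ : ℕ∞) : WithTop ℕ∞) X] [T2Space X] [SecondCountableTopology X] [ConnectedSpace X], Literature.Geometry.Lorentzian.InitialDataSet.IsTameChristodoulouGeneric (Literature.Geometry.Lorentzian.admissibleVacuumData X) (fun D ↦ ∀ 𝒟 : Literature.Geometry.Lorentzian.VacuumCauchyDevelopment D, 𝒟.IsMaximal → Summit.FinalStateConjecture.HasCompleteNullInfinity 𝒟.toCauchyDevelopment ∧ ∀ (O : Set 𝒟.carrier) (q : Literature.Geometry.Lorentzian.QuasiFinalStateDecomposition 𝒟.toSpacetime O 2 ⊤), 𝒟.toCauchyDevelopment.IsLocSettling O q → ∀ i, Literature.Geometry.Lorentzian.Kerr.IsSubextremal (q.mass i) (q.spin i)) 1 := by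
  sorry

/-- **stub** — sub-extremal `C²_loc` holes can be collared (ALL data): every `C²_loc` settling of an MGHD of
admissible data all of whose holes are sub-extremal can be re-charted (new region `O'`, new chart system `q'`) into a
`C²_loc` settling every hole of which carries a `RedShiftedCollarC4`. Why plausibly true: for sub-extremal limits the
red-shift controls transversal derivatives along `𝓗⁺` (Dafermos–Rodnianski 0811.0354 §3.3, §7; DHRT 2104.08222; Hintz
2026 concludes on `{r ≥ m₀}`, `m₀ < r₊`), MOTS sections of the extended `t*`-slices exist between trapped and untrapped
barriers (Andersson–Metzger 2009) and their pencil eigenvalue tends to `κ(M,a) > 0` (Jaramillo 2012, Lemma 1). Why it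
might fail: `C²_loc` exterior convergence does not control the horizon collar at any fixed time (domain of
dependence); large-data horizon regularity is a red-shift theorem still to be proved. Size: L–XL. -/
theorem stub_subextremalCollars :
    ∀ (X : Type) [TopologicalSpace X] [ChartedSpace Literature.Geometry.Lorentzian.E3 X] [IsManifold (𝓡 3) ((⊤ : ℕ∞) : WithTop ℕ∞) X] [T2Space X] [SecondCountableTopology X] [ConnectedSpace X], ∀ D ∈ Literature.Geometry.Lorentzian.admissibleVacuumData X, ∀ 𝒟 : Literature.Geometry.Lorentzian.VacuumCauchyDevelopment D, 𝒟.IsMaximal → ∀ (O : Set 𝒟.carrier) (q : Literature.Geometry.Lorentzian.QuasiFinalStateDecomposition 𝒟.toSpacetime O 2 ⊤), 𝒟.toCauchyDevelopment.IsLocSettling O q → (∀ i, Literature.Geometry.Lorentzian.Kerr.IsSubextremal (q.mass i) (q.spin i)) → ∃ (O' : Set 𝒟.carrier) (q' : Literature.Geometry.Lorentzian.QuasiFinalStateDecomposition 𝒟.toSpacetime O' 2 ⊤), 𝒟.toCauchyDevelopment.IsLocSettling O' q' ∧ ∀ i, 𝒟.toSpacetime.RedShiftedCollarC4 (q'.motion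 i).1 (q'.motion i).2 (q'.mass i) (q'.spin i) q'.τ₀ (q'.chart i) := by
  sorry

/-- Tame Christodoulou genericity is monotone in the property (local copy of
`InitialDataSet.IsTameChristodoulouGeneric.mono`). [folklore] -/
private theorem tameGeneric_mono {X : Type} [TopologicalSpace X]
    [ChartedSpace Literature.Geometry.Lorentzian.E3 X] [IsManifold (𝓡 3) ((⊤ : ℕ∞) : WithTop ℕ∞) X]
    {𝓓 : Set (Literature.Geometry.Lorentzian.InitialDataSet (𝓡 3) X)}
    {P Q : Literature.Geometry.Lorentzian.InitialDataSet (𝓡 3) X → Prop}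
    (h : Literature.Geometry.Lorentzian.InitialDataSet.IsTameChristodoulouGeneric 𝓓 P 1)
    (hPQ : ∀ d ∈ 𝓓, P d → Q d) :
    Literature.Geometry.Lorentzian.InitialDataSet.IsTameChristodoulouGeneric 𝓓 Q 1 := by
  intro d hd
  obtain ⟨e, F, hF, himm, h0, hinj, hD, hE⟩ := h d ⟨hd.1, fun hP ↦ hd.2 (hPQ d hd.1 hP)⟩
  exact ⟨e, F, hF, himm, h0, hinj, hD,
    fun c hc hmem ↦ hE c hc ⟨hmem.1, fun hP ↦ hmem.2 (hPQ _ hmem.1 hP)⟩⟩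

/-- **Composition** — the two stubs give the piece `GenericCensoredCollars` (statement verbatim): genericity is
monotone in the property, and pointwise on admissible data the sub-extremal labels of any `C²_loc` settling feed the
collar construction. [folklore] -/
theorem genericCensoredCollars_frame
    (h₁ : ∀ (X : Type) [TopologicalSpace X] [ChartedSpace Literature.Geometry.Lorentzian.E3 X] [IsManifold (𝓡 3) ((⊤ : ℕ∞) : WithTop ℕ∞) X] [T2Space X] [SecondCountableTopology X] [ConnectedSpace X], Literature.Geometry.Lorentzian.InitialDataSet.IsTameChristodoulouGeneric (Literature.Geometry.Lorentzian.admissibleVacuumData X) (fun D ↦ ∀ 𝒟 : Literature.Geometry.Lorentzian.VacuumCauchyDevelopment D, 𝒟.IsMaximal → Summit.FinalStateConjecture.HasCompleteNullInfinity 𝒟.toCauchyDevelopment ∧ ∀ (O : Set 𝒟.carrier) (q : Literature.Geometry.Lorentzian.QuasiFinalStateDecomposition 𝒟.toSpacetime O 2 ⊤), 𝒟.toCauchyDevelopment.IsLocSettling O q → ∀ i, Literature.Geometry.Lorentzian.Kerr.IsSubextremal (q.mass i) (q.spin i)) 1)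
    (h₂ : ∀ (X : Type) [TopologicalSpace X] [ChartedSpace Literature.Geometry.Lorentzian.E3 X] [IsManifold (𝓡 3) ((⊤ : ℕ∞) : WithTop ℕ∞) X] [T2Space X] [SecondCountableTopology X] [ConnectedSpace X], ∀ D ∈ Literature.Geometry.Lorentzian.admissibleVacuumData X, ∀ 𝒟 : Literature.Geometry.Lorentzian.VacuumCauchyDevelopment D, 𝒟.IsMaximal → ∀ (O : Set 𝒟.carrier) (q : Literature.Geometry.Lorentzian.QuasiFinalStateDecomposition 𝒟.toSpacetime O 2 ⊤), 𝒟.toCauchyDevelopment.IsLocSettling O q → (∀ i, Literature.Geometry.Lorentzian.Kerr.IsSubextremal (q.mass i) (q.spin i)) → ∃ (O' : Set 𝒟.carrier) (q' : Literature.Geometry.Lorentzian.QuasiFinalStateDecomposition 𝒟.toSpacetime O' 2 ⊤), 𝒟.toCauchyDevelopment.IsLocSettling O' q' ∧ ∀ i, 𝒟.toSpacetime.RedShiftedCollarC4 (q'.motion i).1 (q'.motion i).2 (q'.mass i) (q'.spin i) q'.τ₀ (q'.chart i)) :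
    ∀ (X : Type) [TopologicalSpace X] [ChartedSpace Literature.Geometry.Lorentzian.E3 X] [IsManifold (𝓡 3) ((⊤ : ℕ∞) : WithTop ℕ∞) X] [T2Space X] [SecondCountableTopology X] [ConnectedSpace X], Literature.Geometry.Lorentzian.InitialDataSet.IsTameChristodoulouGeneric (Literature.Geometry.Lorentzian.admissibleVacuumData X) (fun D ↦ ∀ 𝒟 : Literature.Geometry.Lorentzian.VacuumCauchyDevelopment D, 𝒟.IsMaximal → Summit.FinalStateConjecture.HasCompleteNullInfinity 𝒟.toCauchyDevelopment ∧ ((∃ (O : Set 𝒟.carrier) (q : Literature.Geometry.Lorentzian.QuasiFinalStateDecomposition 𝒟.toSpacetime O 2 ⊤), 𝒟.toCauchyDevelopment.IsLocSettling O q) → ∃ (O : Set 𝒟.carrier) (q : Literature.Geometry.Lorentzian.QuasiFinalStateDecomposition 𝒟.toSpacetime O 2 ⊤), 𝒟.toCauchyDevelopment.IsLocSettling O q ∧ ∀ i, 𝒟.toSpacetime.RedShiftedCollarC4 (q.motion i).1 (q.motion i).2 (q.mass i) (q.spin i) q.τ₀ (q.chart i))) 1 := by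
  intro X _ _ _ _ _ _
  refine tameGeneric_mono (h₁ X) ?_
  intro D hD hQ 𝒟 h𝒟
  obtain ⟨hscri, hsub⟩ := hQ 𝒟 h𝒟
  refine ⟨hscri, ?_⟩
  rintro ⟨O, q, hloc⟩
  exact h₂ X D hD 𝒟 h𝒟 O q hloc (hsub O q hloc)


/-- **The skeleton concludes the crux BY NAME** (registered shape `<CruxDecl>_of : <CruxDecl>`, the stubs used
inside): the two registered stubs give the route decl `Theses.SpectralSurfaceGravity.GenericCensoredCollars` through the frame
composition `genericCensoredCollars_frame` (whose conclusion is the decl's body, `δ`-unfolding). -/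
theorem GenericCensoredCollars_of :
    Summit.FinalStateConjecture.FinalStateConjecture.Theses.SpectralSurfaceGravity.GenericCensoredCollars :=
  genericCensoredCollars_frame stub_genericCensorshipSubextremal stub_subextremalCollars

end Summit.FinalStateConjecture.FinalStateConjecture.Cruxes.GenericCensoredCollars.Birth

end
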